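import Summits.Langlands.Langlands.Theses.ThreeTorsionCollapse
import Literature.NumberTheory.Automorphic.TotallyRealModularityBoxImagesProofs
import Literature.NumberTheory.Automorphic.FLSThreeFiveSwitchingProofs
import HarnessLib

/-!
# `ThreeTorsionCollapse.ReductionAtThree` BY NAME: kernel calibration against Box 2022,
# Thm. 1.3 (i), conditional closure, and the in-tree trust base
# (item stmt-Langlands-18558, support, rank 9; `--supports`, conditional-result)

The route decl `Summit.Langlands.Langlands.Theses.ThreeTorsionCollapse.ReductionAtThree` — for a
totally real `K` and an integral Weierstrass model `E / 𝓞 K` with `Δ(E) ≠ 0` that is NOT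
automorphic of weight zero, some framing `ρ̄ : Γ_K →ₜ* GL₂(𝔽₃)` of the Galois action on `E[3]`
takes values in the Borel `B(3)` (entry `(1,0)` zero) or in
`C_s⁺(3) = ⟨diag(1,2), (0 1; 1 0)⟩` — is, binder for binder, clause (i) of the tree's named fact
`Literature.NumberTheory.Automorphic.Box2022_theorem1_3` (J. Box, *Elliptic curves over totally
real quartic fields not containing `√5` are modular*, Trans. AMS 375 (2022) = arXiv:2103.13975,
Thm. 1.3 (i), p. 4 of the held text: "Suppose that `E` is a non-modular elliptic curve over a
totally real field `K`. Then (i) `Im(ρ̄_{E,3})` is conjugate to a subgroup of `C_s⁺(3)` or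
`B(3)`"), with the two Literature predicates of that clause written out by their definitions
(cone repair rev 1 of the route): `IsAutomorphicOfWeightZero E` (file
`ReciprocityGLnPotentialModularity.lean`, `frobPoly` inlined) and
`WeierstrassCurve.IsTorsionGaloisRep (E ⊗ K) 3 ρ̄` (file `BCDTModularity.lean`).

This module
* records that identity in the kernel (`reductionAtThree_iff_box_clause_three`, `Iff.rfl`: the
  item neither loses nor gains strength against clause (i) of the fact);
* closes the item AGAINST THE ROUTE DECL BY NAME conditionally (`conditional-result`s):
  from the named fact itself (`reductionAtThree_of_Box2022_theorem1_3`), from the ONE lifting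
  fact its printed proof uses, FLS 2015 Thm. 3 (`reductionAtThree_of_FLS2015_theorem3`, through
  the tree's theorem `Box2022.clause_three` = FLS Thm. 3 + Prop. 9.1 (a) (Rubin), the latter
  PROVED in the tree), from the joint carrier `FLS2015_theorems3_4` that the sibling crux
  skeletons take as hypothesis (`reductionAtThree_of_FLS2015_theorems3_4`), and from FLS Cor. 5.1
  alone = Thm. 3 sliced to `p = 3` (`reductionAtThree_of_corollary5_1`, the exact printed input:
  Thm. 3 at `p = 5` is not used);
* and goes down to the finest seam the tree can express
  (`reductionAtThree_of_strongArtin_of_liftingAtThree`): the Langlands–Tunnell step of Cor. 5.1 is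
  DISCHARGED from the existing named fact `strongArtin_of_isSolvable` (`StrongArtinGL2.lean`,
  through `FLS2015.exists_isPiOfArtinRep_modThreeLift`), so that the item is closed modulo that
  fact and one carrier-less printed input — the rest of Cor. 5.1 (the weight shift of FLS Thm. 6
  after Dieulefait–Freitas, and FLS Thm. 2 at `p = 3` = Breuil–Diamond/Kisin modularity lifting),
  exactly the binder `h3` of `FLS2015_theorem3_of_strongArtin_of_liftingAtThree_of_switching`;
* and proves the CONVERSE unconditionally (`corollary5_1_of_reductionAtThree`): the item implies
  FLS Cor. 5.1 — both cells `B(3)` and `C_s⁺(3)` meet `SL₂(𝔽₃) = ρ̄(Γ_{K(ζ₃)})`-values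
  (`det ρ̄ = χ̄₃`, Weil pairing, a theorem of the tree) in ABELIAN groups (`±(1 b; 0 1)`, resp.
  `{±1, ±(0 1; 2 0)}`), and a plane representation with commutative image is not absolutely
  irreducible — so that `reductionAtThree_iff_corollary5_1`: **the item is EQUIVALENT to FLS
  2015, Cor. 5.1 (= Thm. 3 at `p = 3`)**, axioms `propext`, `Classical.choice`, `Quot.sound`.

An unconditional proof of the item is therefore EXACTLY a proof of FLS 2015, Thm. 3 at `p = 3` on
the tree's carriers (cusp forms on `GL₂(𝔸_K)` with prescribed Hecke polynomials), i.e. a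
formalised modularity lifting theorem at `3` plus Langlands–Tunnell: absent from Mathlib and from
`Literature` (named facts only); there is no cheaper discharge.

This file imports the Theses file and is NOT to be imported by a module that closes an item of
this route by name (the gate's `_holds` link would cycle).

References: [Box2022] Thm. 1.3 (i) and its proof, p. 4; [FreitasLeHungSiksek2015] Thm. 3, Cor. 5.1,
Thm. 6, Thm. 2, Prop. 9.1 (a) (arXiv:1310.7088 pp. 4, 11, 19); [Gelbart1997] Thm. 2.1
(Langlands–Tunnell); [Serre1972] §2.2.
-/

set_option linter.dupNamespace false -- project-wide option (lakefile weak.linter.dupNamespace); `Summit.Langlands.Langlands` is the mandated namespace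

noncomputable section

namespace Summit.Langlands.Langlands.Theorems.ThreeTorsionCollapseReductionAtThree

open scoped NumberField MatrixGroups
open NumberField Field Summit.Langlands.Langlands.Theses.ThreeTorsionCollapse
open Literature.NumberTheory.Automorphic Literature.NumberTheory.GaloisRepresentations

/-! ### Calibration: the item is Box 2022, Thm. 1.3 (i) on the tree's carriers -/

/-- **`ReductionAtThree` is clause (i) of `Box2022_theorem1_3`, definitionally.** The route decl
is the `3`-clause of the named fact with `IsAutomorphicOfWeightZero E` and
`WeierstrassCurve.IsTorsionGaloisRep (E ⊗ K) 3 ρ̄` unfolded (and `frobPoly` inlined); the two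
sides agree by `Iff.rfl`. [cite: Box2022, Thm. 1.3 (i)] -/
theorem reductionAtThree_iff_box_clause_three :
    ReductionAtThree ↔
      ∀ (K : Type) [Field K] [NumberField K] [IsTotallyReal K] (E : WeierstrassCurve (𝓞 K)),
        E.Δ ≠ 0 → ¬ IsAutomorphicOfWeightZero E →
          ∃ ρ : FramedGaloisRep K (ZMod 3) 2, (E.baseChange K).IsTorsionGaloisRep 3 ρ ∧
            ((∀ σ : absoluteGaloisGroup K,
                ((ρ σ : GL (Fin 2) (ZMod 3)) : Matrix (Fin 2) (Fin 2) (ZMod 3)) 1 0 = 0) ∨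
              (∀ σ : absoluteGaloisGroup K, (ρ σ : GL (Fin 2) (ZMod 3)) ∈
                Subgroup.closure ({(⟨!![1, 0; 0, 2], !![1, 0; 0, 2], by decide, by decide⟩ :
                    GL (Fin 2) (ZMod 3)),
                  (⟨!![0, 1; 1, 0], !![0, 1; 1, 0], by decide, by decide⟩ : GL (Fin 2) (ZMod 3))} :
                  Set (GL (Fin 2) (ZMod 3))))) :=
  Iff.rfl

/-! ### Conditional closures by name -/

/-- **`ReductionAtThree` from FLS 2015, Thm. 3** (the one lifting fact of the printed proof of
Box's Thm. 1.3 (i): "Part (i) is a consequence of modularity lifting theorems due amongst others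
to Breuil and Diamond [bd] … See [freitas] … It then follows from [rubin] that `ρ̄_{E,3}` is
conjugate to a subgroup of `C_s⁺(3)` or `B(3)`"); Rubin's step = FLS Prop. 9.1 (a) is a theorem of
the tree, so this is `Box2022.clause_three` read on the route decl. A `conditional-result`: the
item closes with a discharge `FLS2015_theorem3_holds`.
[cite: Box2022, Thm. 1.3 (i) and its proof] [cite: FreitasLeHungSiksek2015, Thm. 3 and Prop. 9.1 (a)] -/
theorem reductionAtThree_of_FLS2015_theorem3 (h3 : FLS2015_theorem3) : ReductionAtThree := by
  intro K _ _ _ E hΔ hne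
  exact Box2022.clause_three h3 K E hΔ hne

/-- **`ReductionAtThree` from the named fact `Box2022_theorem1_3`** (its clause (i), by name: the
by-name support as filed by the planner). A `conditional-result`.
[cite: Box2022, Thm. 1.3 (i)] -/
theorem reductionAtThree_of_Box2022_theorem1_3 (h : Box2022_theorem1_3) : ReductionAtThree :=
  reductionAtThree_iff_box_clause_three.mpr fun K _ _ _ E hΔ hne => (h K E hΔ hne).1

/-- **`ReductionAtThree` from the joint carrier `FLS2015_theorems3_4`** (FLS Thms. 3–4,
`p ∈ {3, 5, 7}`, the hypothesis taken by the two crux skeletons of this route); only its `p = 3`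
part is used. A `conditional-result`.
[cite: FreitasLeHungSiksek2015, Thm. 3] [cite: Box2022, Thm. 1.3 (i)] -/
theorem reductionAtThree_of_FLS2015_theorems3_4 (h : FLS2015_theorems3_4) : ReductionAtThree :=
  reductionAtThree_of_FLS2015_theorem3 (FLS2015_theorem3_of_theorems3_4 h)

/-! ### The exact printed input: FLS Cor. 5.1 (= Thm. 3 at `p = 3` only) -/

/-- **The mod-`3` dichotomy from FLS Cor. 5.1 alone.** If `E / 𝓞 K` (`K` totally real, `Δ ≠ 0`)
is not automorphic of weight zero, then some framing `ρ̄` of `E[3]` is reducible or has image the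
normaliser of a split Cartan subgroup — assuming only Cor. 5.1 ("if `ρ̄_{E,3}(G_{K(ζ₃)})` is
absolutely irreducible, then `E` is modular … It is of course Theorem 3 with `p = 3`"), spelled as
the `p = 3` slice of `FLS2015_theorem3` (binder `h51` of
`FLS2015_theorem3_of_corollary5_1_of_switching`). The proof is that of
`FLS2015.mod3_dichotomy_of_not_isAutomorphicOfWeightZero` with Cor. 5.1 in place of Thm. 3:
contrapose Cor. 5.1 to get a framing not absolutely irreducible on some model of `K(ζ₃)`, then
Prop. 9.1 (a) (`FLS2015.prop9_1a_of_isTorsionGaloisRep`, proved) in the irreducible case.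
[cite: FreitasLeHungSiksek2015, Cor. 5.1 and Prop. 9.1 (a)] -/
theorem mod3Dichotomy_of_corollary5_1
    (h51 : ∀ (K : Type) [Field K] [NumberField K] [IsTotallyReal K] (E : WeierstrassCurve (𝓞 K)),
      E.Δ ≠ 0 → ∀ (p : ℕ) [Fact p.Prime], p = 3 →
        ModPImageAbsIrreducibleOverCyclotomic (E.baseChange K) p → IsAutomorphicOfWeightZero E)
    (K : Type) [Field K] [NumberField K] [IsTotallyReal K] (E : WeierstrassCurve (𝓞 K))
    (hΔ : E.Δ ≠ 0) (hE : ¬ IsAutomorphicOfWeightZero E) :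
    ∃ ρ : ModPGaloisRep K (ZMod 3) 2, (E.baseChange K).IsTorsionGaloisRep 3 ρ ∧
      (¬ FramedRep.IsIrreducible ρ ∨
        ∃ P : GL (Fin 2) (ZMod 3), ρ.toMonoidHom.range =
          Subgroup.normalizer (Serre1972.splitCartan P : Set (GL (Fin 2) (ZMod 3)))) := by
  haveI : Fact (Nat.Prime 3) := ⟨by norm_num⟩
  haveI := FLS2015.isElliptic_baseChange hΔ
  -- Cor. 5.1 (contrapositive): some framing restricted to some model of `K(ζ₃)` is not
  -- absolutely irreducible
  obtain ⟨ρ, hρ, L, _, _, _, hred⟩ :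
      ∃ ρ : ModPGaloisRep K (ZMod 3) 2, (E.baseChange K).IsTorsionGaloisRep 3 ρ ∧
        ∃ (L : Type) (_ : Field L) (_ : Algebra K L) (_ : IsCyclotomicExtension {3} K L),
          ¬ FramedRep.IsAbsolutelyIrreducible (FramedGaloisRep.restrictField L ρ) := by
    by_contra hall
    push Not at hall
    refine hE (h51 K E hΔ 3 rfl ?_)
    intro ρ hρ L _ _ _
    exact hall ρ hρ L inferInstance inferInstance inferInstance
  refine ⟨ρ, hρ, ?_⟩
  by_cases hirr : FramedRep.IsIrreducible ρ
  · exact Or.inr (FLS2015.prop9_1a_of_isTorsionGaloisRep (E.baseChange K) hρ hirr L hred)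
  · exact Or.inl hirr

/-- **`ReductionAtThree` from FLS Cor. 5.1 alone** (the `p = 3` slice of `FLS2015_theorem3`; the
`p = 5` half of Thm. 3 is not used): the dichotomy `mod3Dichotomy_of_corollary5_1`, then the
change of framing of `Box2022.clause_three` — a reducible framing is made upper triangular
(`FLS2015.exists_isTorsionGaloisRep_borel_of_not_isIrreducible`), a framing with image
`N(P (* 0; 0 *) P⁻¹)` is conjugated by `P⁻¹` into the diagonal-or-antidiagonal matrices
(`Serre1972.mem_normalizer_splitCartan_iff`), which lie in `⟨diag(1,2), (0 1; 1 0)⟩`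
(`Box2022.mem_closure_Cs3_of_isDg_or_isAd`). A `conditional-result` on a carrier-less printed
input. [cite: Box2022, Thm. 1.3 (i) and its proof] [cite: FreitasLeHungSiksek2015, Cor. 5.1 and Prop. 9.1 (a)] -/
theorem reductionAtThree_of_corollary5_1
    (h51 : ∀ (K : Type) [Field K] [NumberField K] [IsTotallyReal K] (E : WeierstrassCurve (𝓞 K)),
      E.Δ ≠ 0 → ∀ (p : ℕ) [Fact p.Prime], p = 3 →
        ModPImageAbsIrreducibleOverCyclotomic (E.baseChange K) p → IsAutomorphicOfWeightZero E) :
    ReductionAtThree := by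
  intro K _ _ _ E hΔ hne
  have hF : ∃ u : (ZMod 3)ˣ, u ≠ 1 := ⟨-1, by decide⟩
  haveI : Fact (Nat.Prime 3) := ⟨by norm_num⟩
  obtain ⟨ρ, hρ, h⟩ := mod3Dichotomy_of_corollary5_1 h51 K E hΔ hne
  rcases h with hnirr | ⟨P, hP⟩
  · obtain ⟨ρ', hρ', hB⟩ := FLS2015.exists_isTorsionGaloisRep_borel_of_not_isIrreducible hρ hnirr
    exact ⟨ρ', hρ', Or.inl hB⟩
  · refine ⟨FramedRep.conj P⁻¹ ρ, FLS2015.isTorsionGaloisRep_conj hρ P⁻¹, Or.inr fun σ => ?_⟩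
    have hmem : ρ σ ∈ Subgroup.normalizer (Serre1972.splitCartan P : Set (GL (Fin 2) (ZMod 3))) := by
      rw [← hP]; exact ⟨σ, rfl⟩
    have h := (Serre1972.mem_normalizer_splitCartan_iff hF).mp hmem
    rw [FramedRep.conj_apply, inv_inv]
    exact Box2022.mem_closure_Cs3_of_isDg_or_isAd h

/-! ### The in-tree trust base: Langlands–Tunnell discharged, one carrier-less lifting input -/

/-- **`ReductionAtThree` closed modulo the existing fact `strongArtin_of_isSolvable` and ONE
carrier-less printed input.** Cor. 5.1 = Thm. 6 (Langlands–Tunnell: "`ρ̄_{E,3}` irreducible ⇒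
`ρ̄_{E,3}` modular") + Thm. 2 at `p = 3` (Breuil–Diamond/Kisin lifting); its Langlands–Tunnell
step is DISCHARGED from `hSA : strongArtin_of_isSolvable` (Langlands 1980 + Tunnell 1981, the
tree's named fact of `StrongArtinGL2.lean`) through `FLS2015.exists_isPiOfArtinRep_modThreeLift`
(under the image hypothesis every framing of `E[3]` is absolutely irreducible,
`ModPImageAbsIrreducibleOverCyclotomic.isAbsolutelyIrreducible`, so `π(Ψ ∘ ρ̄)` exists on
`GL₂(𝔸_K)`), and what remains is the hypothesis `h3` — for `E / 𝓞 K` (`K` totally real,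
`Δ ≠ 0`) such that `π(Ψ ∘ ρ̄)` exists for every framing `ρ̄` of `E[3]` and `ρ̄_{E,3}(G_{K(ζ₃)})`
is absolutely irreducible, `E` is automorphic of weight zero (in print: the weight shift of
Thm. 6 after Dieulefait–Freitas, then Thm. 2 at `p = 3`) — token for token the binder `h3` of
`FLS2015_theorem3_of_strongArtin_of_liftingAtThree_of_switching`; the `3–5` switching inputs
`h2`, `h61` of that theorem are NOT needed here. This is the honest trust base of the item in the
present tree. [cite: FreitasLeHungSiksek2015, Cor. 5.1, Thm. 6 (§5), Thm. 2]
[cite: Gelbart1997, Thm. 2.1] [cite: Box2022, Thm. 1.3 (i) and its proof] -/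
theorem reductionAtThree_of_strongArtin_of_liftingAtThree (hSA : strongArtin_of_isSolvable)
    (h3 : ∀ (K : Type) [Field K] [NumberField K] [IsTotallyReal K] (E : WeierstrassCurve (𝓞 K)),
      E.Δ ≠ 0 →
        (∀ ρ : ModPGaloisRep K (ZMod 3) 2, (E.baseChange K).IsTorsionGaloisRep 3 ρ →
          ∃ (hcpt : isCompact_glFiniteIntegralLevel 2 K) (π : CuspidalAutomorphicRepData 2 K hcpt),
            IsPiOfArtinRep (modThreeLift ρ) π.1) →
        ModPImageAbsIrreducibleOverCyclotomic (E.baseChange K) 3 → IsAutomorphicOfWeightZero E) :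
    ReductionAtThree :=
  reductionAtThree_of_corollary5_1 fun K _ _ _ E hΔ p _ hp himg => by
    subst hp
    exact h3 K E hΔ
      (fun ρ hρ => FLS2015.exists_isPiOfArtinRep_modThreeLift hSA ρ
        (himg.isAbsolutelyIrreducible hρ))
      himg

/-! ### The converse: the item IMPLIES FLS Cor. 5.1 (so it is equivalent to it)

Both cells of the conclusion of `ReductionAtThree` meet `SL₂(𝔽₃)` in an ABELIAN group: the
upper-triangular matrices of determinant `1` are `±(1 b; 0 1)`, and the diagonal-or-antidiagonal
matrices of determinant `1` are `{±1, ±(0 1; 2 0)}` (cyclic of order `4`). Since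
`ρ̄(Γ_{K(ζ₃)}) = ρ̄(Γ_K) ∩ SL₂(𝔽₃)` (`det ρ̄ = χ̄₃`, Weil pairing — a theorem of the tree), the
restriction of such a framing to `Γ_{K(ζ₃)}` has commutative image, hence is NOT absolutely
irreducible (`FramedRep.exists_mul_ne_mul_of_isAbsolutelyIrreducible`). Contraposed: under the
image hypothesis of Cor. 5.1 the curve is automorphic of weight zero. -/

/-- Upper-triangular `2 × 2` matrices with equal diagonal entries commute (over any commutative
ring): `(x y; 0 x)(x' y'; 0 x') = (xx' xy'+yx'; 0 xx')`. [folklore] -/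
theorem mul_comm_of_upper {R : Type*} [CommRing R] {A B : Matrix (Fin 2) (Fin 2) R}
    (hA : A 1 0 = 0) (hA' : A 1 1 = A 0 0) (hB : B 1 0 = 0) (hB' : B 1 1 = B 0 0) :
    A * B = B * A := by
  ext i j
  fin_cases i <;> fin_cases j <;>
    simp [Matrix.mul_apply, Fin.sum_univ_two, hA, hA', hB, hB'] <;> ring

/-- Scalar matrices and the multiples of `(0 1; c 0)` (a fixed `c`) pairwise commute (over any
commutative ring): `(0 x; cx 0)(0 y; cy 0) = cxy · 1`. [folklore] -/
theorem mul_comm_of_scalar_or_antidiag {R : Type*} [CommRing R] (c : R)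
    {A B : Matrix (Fin 2) (Fin 2) R}
    (hA : (A 0 1 = 0 ∧ A 1 0 = 0 ∧ A 1 1 = A 0 0) ∨ (A 0 0 = 0 ∧ A 1 1 = 0 ∧ A 1 0 = c * A 0 1))
    (hB : (B 0 1 = 0 ∧ B 1 0 = 0 ∧ B 1 1 = B 0 0) ∨ (B 0 0 = 0 ∧ B 1 1 = 0 ∧ B 1 0 = c * B 0 1)) :
    A * B = B * A := by
  rcases hA with ⟨hA₁, hA₂, hA₃⟩ | ⟨hA₁, hA₂, hA₃⟩ <;> rcases hB with ⟨hB₁, hB₂, hB₃⟩ | ⟨hB₁, hB₂, hB₃⟩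
  all_goals
    ext i j
    fin_cases i <;> fin_cases j <;>
      simp [Matrix.mul_apply, Fin.sum_univ_two, hA₁, hA₂, hA₃, hB₁, hB₂, hB₃] <;> ring

/-- **`B(3) ∩ SL₂(𝔽₃)` is abelian**: two upper-triangular elements of `GL₂(𝔽₃)` of determinant `1`
commute (`ad = 1` in `𝔽₃` forces `a = d`). [folklore] -/
theorem GL2F3.mul_comm_of_borel_of_det_eq_one {g h : GL (Fin 2) (ZMod 3)}
    (hg : ((g : GL (Fin 2) (ZMod 3)) : Matrix (Fin 2) (Fin 2) (ZMod 3)) 1 0 = 0)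
    (hgd : Matrix.GeneralLinearGroup.det g = 1)
    (hh : ((h : GL (Fin 2) (ZMod 3)) : Matrix (Fin 2) (Fin 2) (ZMod 3)) 1 0 = 0)
    (hhd : Matrix.GeneralLinearGroup.det h = 1) : g * h = h * g := by
  have key : ∀ x y : ZMod 3, x * y - 0 = 1 → y = x := by decide
  have hdet : ∀ {u : GL (Fin 2) (ZMod 3)}, Matrix.GeneralLinearGroup.det u = 1 →
      ((u : GL (Fin 2) (ZMod 3)) : Matrix (Fin 2) (Fin 2) (ZMod 3)).det = 1 := fun hu => by
    rw [← Matrix.GeneralLinearGroup.val_det_apply, hu, Units.val_one]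
  have hg' := hdet hgd
  have hh' := hdet hhd
  rw [Matrix.det_fin_two, hg, mul_zero] at hg'
  rw [Matrix.det_fin_two, hh, mul_zero] at hh'
  refine Units.ext ?_
  rw [Units.val_mul, Units.val_mul]
  exact mul_comm_of_upper hg (key _ _ hg') hh (key _ _ hh')

/-- **`C_s⁺(3) ∩ SL₂(𝔽₃)` is abelian**: two diagonal-or-antidiagonal elements of `GL₂(𝔽₃)` of
determinant `1` commute (they are `±1` or `±(0 1; 2 0)`). [folklore] -/
theorem GL2F3.mul_comm_of_isDg_or_isAd_of_det_eq_one {g h : GL (Fin 2) (ZMod 3)}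
    (hg : GL2.IsDg ((g : GL (Fin 2) (ZMod 3)) : Matrix (Fin 2) (Fin 2) (ZMod 3)) ∨
      GL2.IsAd ((g : GL (Fin 2) (ZMod 3)) : Matrix (Fin 2) (Fin 2) (ZMod 3)))
    (hgd : Matrix.GeneralLinearGroup.det g = 1)
    (hh : GL2.IsDg ((h : GL (Fin 2) (ZMod 3)) : Matrix (Fin 2) (Fin 2) (ZMod 3)) ∨
      GL2.IsAd ((h : GL (Fin 2) (ZMod 3)) : Matrix (Fin 2) (Fin 2) (ZMod 3)))
    (hhd : Matrix.GeneralLinearGroup.det h = 1) : g * h = h * g := by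
  have key₁ : ∀ x y : ZMod 3, x * y - 0 = 1 → y = x := by decide
  have key₂ : ∀ x y : ZMod 3, 0 - x * y = 1 → y = 2 * x := by decide
  have hdet : ∀ {u : GL (Fin 2) (ZMod 3)}, Matrix.GeneralLinearGroup.det u = 1 →
      ((u : GL (Fin 2) (ZMod 3)) : Matrix (Fin 2) (Fin 2) (ZMod 3)).det = 1 := fun hu => by
    rw [← Matrix.GeneralLinearGroup.val_det_apply, hu, Units.val_one]
  -- normal form of an element of either shape with determinant `1`
  have shape : ∀ {u : GL (Fin 2) (ZMod 3)},
      (GL2.IsDg ((u : GL (Fin 2) (ZMod 3)) : Matrix (Fin 2) (Fin 2) (ZMod 3)) ∨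
        GL2.IsAd ((u : GL (Fin 2) (ZMod 3)) : Matrix (Fin 2) (Fin 2) (ZMod 3))) →
      Matrix.GeneralLinearGroup.det u = 1 →
      (((u : Matrix (Fin 2) (Fin 2) (ZMod 3)) 0 1 = 0 ∧ (u : Matrix (Fin 2) (Fin 2) (ZMod 3)) 1 0 = 0 ∧
          (u : Matrix (Fin 2) (Fin 2) (ZMod 3)) 1 1 = (u : Matrix (Fin 2) (Fin 2) (ZMod 3)) 0 0) ∨
        ((u : Matrix (Fin 2) (Fin 2) (ZMod 3)) 0 0 = 0 ∧ (u : Matrix (Fin 2) (Fin 2) (ZMod 3)) 1 1 = 0 ∧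
          (u : Matrix (Fin 2) (Fin 2) (ZMod 3)) 1 0 = 2 * (u : Matrix (Fin 2) (Fin 2) (ZMod 3)) 0 1)) := by
    intro u hu hud
    have hd := hdet hud
    rw [Matrix.det_fin_two] at hd
    rcases hu with ⟨h01, h10⟩ | ⟨h00, h11⟩
    · rw [h10, mul_zero] at hd
      exact Or.inl ⟨h01, h10, key₁ _ _ hd⟩
    · rw [h00, zero_mul] at hd
      exact Or.inr ⟨h00, h11, key₂ _ _ hd⟩
  refine Units.ext ?_
  rw [Units.val_mul, Units.val_mul]
  exact mul_comm_of_scalar_or_antidiag 2 (shape hg hgd) (shape hh hhd)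

/-- **`C_s⁺(3) = ⟨diag(1,2), (0 1; 1 0)⟩` normalises the diagonal split Cartan subgroup**, so its
elements are diagonal or antidiagonal (`Serre1972.mem_normalizer_splitCartan_iff`).
[cite: Serre1972, §2.2] -/
theorem GL2F3.isDg_or_isAd_of_mem_closure_Cs3 {g : GL (Fin 2) (ZMod 3)}
    (hg : g ∈ Subgroup.closure ({(⟨!![1, 0; 0, 2], !![1, 0; 0, 2], by decide, by decide⟩ :
          GL (Fin 2) (ZMod 3)),
        (⟨!![0, 1; 1, 0], !![0, 1; 1, 0], by decide, by decide⟩ : GL (Fin 2) (ZMod 3))} :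
        Set (GL (Fin 2) (ZMod 3)))) :
    GL2.IsDg ((g : GL (Fin 2) (ZMod 3)) : Matrix (Fin 2) (Fin 2) (ZMod 3)) ∨
      GL2.IsAd ((g : GL (Fin 2) (ZMod 3)) : Matrix (Fin 2) (Fin 2) (ZMod 3)) := by
  have hF : ∃ u : (ZMod 3)ˣ, u ≠ 1 := ⟨-1, by decide⟩
  have hiff : ∀ x : GL (Fin 2) (ZMod 3),
      x ∈ Subgroup.normalizer (Serre1972.splitCartan (1 : GL (Fin 2) (ZMod 3)) : Set (GL (Fin 2) (ZMod 3))) ↔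
        GL2.IsDg ((x : GL (Fin 2) (ZMod 3)) : Matrix (Fin 2) (Fin 2) (ZMod 3)) ∨
          GL2.IsAd ((x : GL (Fin 2) (ZMod 3)) : Matrix (Fin 2) (Fin 2) (ZMod 3)) := fun x => by
    rw [Serre1972.mem_normalizer_splitCartan_iff hF, inv_one, one_mul, mul_one]
  have hle : Subgroup.closure ({(⟨!![1, 0; 0, 2], !![1, 0; 0, 2], by decide, by decide⟩ :
          GL (Fin 2) (ZMod 3)),
        (⟨!![0, 1; 1, 0], !![0, 1; 1, 0], by decide, by decide⟩ : GL (Fin 2) (ZMod 3))} :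
        Set (GL (Fin 2) (ZMod 3))) ≤
      Subgroup.normalizer (Serre1972.splitCartan (1 : GL (Fin 2) (ZMod 3)) : Set (GL (Fin 2) (ZMod 3))) := by
    rw [Subgroup.closure_le]
    rintro x (rfl | rfl)
    · exact (hiff _).mpr (Or.inl ⟨rfl, rfl⟩)
    · exact (hiff _).mpr (Or.inr ⟨rfl, rfl⟩)
  exact (hiff g).mp (hle hg)

/-- **`ReductionAtThree` implies FLS Cor. 5.1** (Thm. 3 at `p = 3`, spelled as the `p = 3` slice
of `FLS2015_theorem3`). Given the image hypothesis (`ρ̄|_{Γ_L}` absolutely irreducible for EVERY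
framing `ρ̄` of `E[3]` and every model `L` of `K(ζ₃)`), suppose `E` were not automorphic of weight
zero; `ReductionAtThree` gives a framing with values in `B(3)` or in `C_s⁺(3)`; on
`Γ_{K(ζ₃)}` (Mathlib's `CyclotomicField 3 K`) its values also have determinant `1`
(`range_restrictField_cyclotomic_eq_of_isTorsionGaloisRep`: `det ρ̄ = χ̄₃` by the Weil pairing,
a theorem of the tree), so they pairwise commute (`GL2F3.mul_comm_of_borel_of_det_eq_one`,
`GL2F3.mul_comm_of_isDg_or_isAd_of_det_eq_one`), contradicting absolute irreducibility
(`FramedRep.exists_mul_ne_mul_of_isAbsolutelyIrreducible`). Unconditional.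
[cite: FreitasLeHungSiksek2015, Cor. 5.1 and Prop. 4.1 (i)] [cite: Box2022, Thm. 1.3 (i)] -/
theorem corollary5_1_of_reductionAtThree (hR : ReductionAtThree) (K : Type) [Field K]
    [NumberField K] [IsTotallyReal K] (E : WeierstrassCurve (𝓞 K)) (hΔ : E.Δ ≠ 0) (p : ℕ)
    [Fact p.Prime] (hp : p = 3) (himg : ModPImageAbsIrreducibleOverCyclotomic (E.baseChange K) p) :
    IsAutomorphicOfWeightZero E := by
  subst hp
  by_contra hne
  haveI := FLS2015.isElliptic_baseChange hΔ
  haveI : NeZero ((3 : ℕ) : K) := NeZero.charZero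
  obtain ⟨ρ, hρ, hBC⟩ := hR K E hΔ hne
  have habs : FramedRep.IsAbsolutelyIrreducible
      (FramedGaloisRep.restrictField (CyclotomicField 3 K) ρ) := himg ρ hρ (CyclotomicField 3 K)
  obtain ⟨τ, τ', hne'⟩ := FramedRep.exists_mul_ne_mul_of_isAbsolutelyIrreducible _ habs
  apply hne'
  have hrange := range_restrictField_cyclotomic_eq_of_isTorsionGaloisRep (E.baseChange K) 3
    ((E.baseChange K).det_eq_modPCyclotomicCharacter_of_isTorsionGaloisRep_holds 3) hρ
    (CyclotomicField 3 K)
  have hdet1 : ∀ t : absoluteGaloisGroup (CyclotomicField 3 K),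
      Matrix.GeneralLinearGroup.det (ρ (absGaloisRestrict K (CyclotomicField 3 K) t)) = 1 := by
    intro t
    have hmem : FramedGaloisRep.restrictField (CyclotomicField 3 K) ρ t ∈
        (FramedGaloisRep.restrictField (CyclotomicField 3 K) ρ).toMonoidHom.range := ⟨t, rfl⟩
    rw [hrange] at hmem
    exact (MonoidHom.mem_ker).1 (Subgroup.mem_inf.1 hmem).2
  rw [FramedGaloisRep.restrictField_apply, FramedGaloisRep.restrictField_apply]
  rcases hBC with hB | hC
  · exact GL2F3.mul_comm_of_borel_of_det_eq_one (hB _) (hdet1 τ) (hB _) (hdet1 τ')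
  · exact GL2F3.mul_comm_of_isDg_or_isAd_of_det_eq_one (GL2F3.isDg_or_isAd_of_mem_closure_Cs3 (hC _))
      (hdet1 τ) (GL2F3.isDg_or_isAd_of_mem_closure_Cs3 (hC _)) (hdet1 τ')

/-- **The item is EQUIVALENT to FLS 2015, Cor. 5.1 (= Thm. 3 at `p = 3`) on the tree's
carriers.** `ReductionAtThree` ⇔ "for every totally real `K` and every `E / 𝓞 K` with `Δ ≠ 0`,
if `ρ̄_{E,3}(G_{K(ζ₃)})` is absolutely irreducible (all framings, all models of `K(ζ₃)`) then `E`
is automorphic of weight zero" — `reductionAtThree_of_corollary5_1` and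
`corollary5_1_of_reductionAtThree`. So the support is exactly as strong as the modularity
lifting theorem at `3` (Langlands–Tunnell + Breuil–Diamond/Kisin) that Box's proof cites; there
is no cheaper discharge. [cite: FreitasLeHungSiksek2015, Cor. 5.1, Thm. 3, Prop. 9.1 (a)]
[cite: Box2022, Thm. 1.3 (i) and its proof] -/
theorem reductionAtThree_iff_corollary5_1 :
    ReductionAtThree ↔
      ∀ (K : Type) [Field K] [NumberField K] [IsTotallyReal K] (E : WeierstrassCurve (𝓞 K)),
        E.Δ ≠ 0 → ∀ (p : ℕ) [Fact p.Prime], p = 3 →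
          ModPImageAbsIrreducibleOverCyclotomic (E.baseChange K) p → IsAutomorphicOfWeightZero E :=
  ⟨fun hR K _ _ _ E hΔ p _ hp himg => corollary5_1_of_reductionAtThree hR K E hΔ p hp himg,
    reductionAtThree_of_corollary5_1⟩

end Summit.Langlands.Langlands.Theorems.ThreeTorsionCollapseReductionAtThree

end
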